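import Literature.AnabelianGeometry.AbsoluteAnabelian.AbsTopIThm26iiiTransportProofs
import Literature.AnabelianGeometry.AbsoluteAnabelian.AbsTopIThm26iiiProofs
import Literature.AnabelianGeometry.AbsoluteAnabelian.AbsTopIThm26ivProofs
import Literature.AnabelianGeometry.AbsoluteAnabelian.AbsTopII.Remark332Proofs
import HarnessLib

/-!
# [AbsTopI] Thm 2.6 (v), general form: `Θ`, `ζ̃` are "group-theoretic", and `Δ ⊆ Π` is characteristic

S. Mochizuki, *Topics in Absolute Anabelian Geometry I: Generalities* (2012) [AbsTopI], Thm 2.6 (v),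
manuscript p. 22 (lit key `paper:url-11ac98ba15fc`): "`ζ̃(Π) := ζ(Π/Θ) = [k : ℚ_p]` [...] In particular,
the kernel of the quotient `Π ↠ G` may be characterized ["group-theoretically" — since "`θ²(−)`", "`ζ(−)`",
"`ζ̃(−)`" are "group-theoretic"] as the intersection of the open subgroups `H ⊆ Π` such that
`ζ̃(H)/ζ̃(Π) = [Π : H]`" — typed as `FundamentalExtension.Thm26vFull` (abc-iut-L4, `AbsTopIThm26iii.lean`),
with `Θ = thetaSubgroup` ("the maximal almost pro-omissive topologically finitely generated closed normal
subgroup of `Π`, whenever a unique such maximal subgroup exists [and `θ²(Π) ≠ Primes`]; [...] otherwise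
`Θ := {1}`") and `ζ̃ = zetaTildeInv`.

PROOF-ONLY file (no definitions, no named facts).  The "group-theoretic" clause is what the [IUTchI–IV]
citations of Thm 2.6 use ("the subgroup `Δ ⊆ Π` may be characterized group-theoretically", [IUTchI] p. 73,
[IUTchII] pp. 35, 71, 120): it says that the data `Θ`, `ζ̃`, and hence `Δ`, are TRANSPORTED by every
isomorphism of topological groups.  abc-iut-L4's `Remark332Proofs.lean` proves this for the `Θ = {1}`
typing `Thm26v` (`preservesGeom_of_thm26v`) and abc-iut-w6-d073 / w6-d074's `AbsTopIThm26iiiTransportProofs.lean`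
transports `δʲ_l`, `εʲ_l`, `θʲ`; THIS file closes the general-`Θ` form:

* `IsAlmostProOmissive.of_continuousMulEquiv`, `isAlmostProOmissive_map_continuousMulEquiv` — almost
  pro-omissivity is an invariant of the topological group / transports to image subgroups;
* `isMaximalAPONormal_map_continuousMulEquiv` (+ `_iff`) — "maximal almost pro-omissive tfg closed normal
  subgroup" transports along `e : A ⥲ B`, `N ↦ e(N)`;
* `thetaSubgroup_map_continuousMulEquiv` — **`e(Θ_A) = Θ_B`** (uniqueness of the maximal subgroup, and
  `θ²(A) = θ²(B)`);
* `zetaTildeInv_eq_of_continuousMulEquiv` — **`ζ̃(A) = ζ̃(B)`** (`A/Θ_A ⥲ B/Θ_B` bicontinuously, then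
  `zetaInv_eq_of_continuousMulEquiv`);
* `FundamentalExtension.geom_map_eq_of_zetaTilde_characterization`, **`preservesGeom_of_thm26vFull`** — for
  extensions `E`, `F` with MLF base data satisfying `Thm26vFull`, EVERY isomorphism of topological groups
  `Π_E ⥲ Π_F` carries `Δ_E` onto `Δ_F` ([AbsAnab] Lemma 1.3.8 shape `PreservesGeom`), and the self-form
  `geom_map_eq_self_of_thm26vFull` (the hypothesis shape `∀ φ, PreservesGeom φ` of the tempered / curve-level
  (H1) reductions `ThetaSetting.deltaX_map_eq_of_completion_compatible`,
  `TemperedCurve.isTopCharacteristic_deltaTemp_of_completion_compatible`).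

HONEST FRAMING: refereed, undisputed statement; abc-iut cell, block C seat abc-iut-w6-d027 gen 3 (row
«THM26VFULL-TRANSPORT», answering L4-lead RULING #8f (5)); nothing here bears on [IUTchIII] Cor. 3.12;
typed ≠ proved elsewhere.
-/

noncomputable section

open Topology

namespace Literature.AnabelianGeometry.AbsoluteAnabelian

universe u

/-! ### Transport of subgroups along `e : A ⥲ B` (folklore plumbing) -/

section Transport

variable {A B : Type u} [Group A] [TopologicalSpace A] [IsTopologicalGroup A]
  [Group B] [TopologicalSpace B] [IsTopologicalGroup B]

omit [IsTopologicalGroup A] [IsTopologicalGroup B] in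
/-- The underlying set of the image subgroup along `e` is the image set. [folklore] -/
private theorem coe_map_continuousMulEquiv_eq_image (e : A ≃ₜ* B) (N : Subgroup A) :
    ((N.map e.toMulEquiv.toMonoidHom : Subgroup B) : Set B) = e '' (N : Set A) := by
  ext y
  simp only [Subgroup.coe_map, Set.mem_image, SetLike.mem_coe]
  exact Iff.rfl

omit [IsTopologicalGroup A] [IsTopologicalGroup B] in
/-- Membership in the image subgroup along `e` is membership of `e⁻¹ y`. [folklore] -/
private theorem mem_map_continuousMulEquiv_iff_symm_mem (e : A ≃ₜ* B) (N : Subgroup A) (y : B) :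
    y ∈ N.map e.toMulEquiv.toMonoidHom ↔ e.symm y ∈ N := by
  constructor
  · rintro ⟨x, hx, rfl⟩
    change e.symm (e x) ∈ N
    rwa [e.symm_apply_apply]
  · intro h
    exact ⟨e.symm y, h, e.apply_symm_apply y⟩

omit [IsTopologicalGroup A] [IsTopologicalGroup B] in
/-- `e⁻¹(e(N)) = N` for subgroups. [folklore] -/
private theorem map_map_symm_continuousMulEquiv (e : A ≃ₜ* B) (N : Subgroup A) :
    (N.map e.toMulEquiv.toMonoidHom).map e.symm.toMulEquiv.toMonoidHom = N := by
  ext x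
  rw [mem_map_continuousMulEquiv_iff_symm_mem, mem_map_continuousMulEquiv_iff_symm_mem,
    e.symm_symm, e.symm_apply_apply]

omit [IsTopologicalGroup A] [IsTopologicalGroup B] in
/-- A subgroup is bicontinuously isomorphic to its image along `e` (existence form: no data declared).
[folklore] -/
private theorem nonempty_continuousMulEquiv_map_subgroup (e : A ≃ₜ* B) (N : Subgroup A) :
    Nonempty (N ≃ₜ* (N.map e.toMulEquiv.toMonoidHom : Subgroup B)) := by
  refine ⟨{ toFun := fun x => ⟨e x, ⟨x, x.2, rfl⟩⟩
            invFun := fun y => ⟨e.symm y, (mem_map_continuousMulEquiv_iff_symm_mem e N y).mp y.2⟩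
            left_inv := fun x => Subtype.ext (e.symm_apply_apply x)
            right_inv := fun y => Subtype.ext (e.apply_symm_apply y)
            map_mul' := fun x y => Subtype.ext (map_mul e (x : A) (y : A))
            continuous_toFun := ?_
            continuous_invFun := ?_ }⟩
  · exact (e.continuous.comp continuous_subtype_val).subtype_mk _
  · exact (e.symm.continuous.comp continuous_subtype_val).subtype_mk _

omit [IsTopologicalGroup A] [IsTopologicalGroup B] in
/-- A subgroup of `B` is bicontinuously isomorphic to its preimage along `e` (existence form). [folklore] -/
private theorem nonempty_continuousMulEquiv_comap_subgroup (e : A ≃ₜ* B) (H : Subgroup B) :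
    Nonempty ((H.comap e.toMulEquiv.toMonoidHom : Subgroup A) ≃ₜ* H) := by
  refine ⟨{ toFun := fun x => ⟨e x, x.2⟩
            invFun := fun y => ⟨e.symm y, by
              change e (e.symm y) ∈ H
              rw [e.apply_symm_apply]; exact y.2⟩
            left_inv := fun x => Subtype.ext (e.symm_apply_apply x)
            right_inv := fun y => Subtype.ext (e.apply_symm_apply y)
            map_mul' := fun x y => Subtype.ext (map_mul e (x : A) (y : A))
            continuous_toFun := ?_
            continuous_invFun := ?_ }⟩
  · exact (e.continuous.comp continuous_subtype_val).subtype_mk _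
  · exact (e.symm.continuous.comp continuous_subtype_val).subtype_mk _

omit [IsTopologicalGroup A] [IsTopologicalGroup B] in
/-- **Almost pro-omissivity is an invariant of the topological group.**  If `G` admits an open
pro-prime-to-`p` subgroup `U`, then `e(U)` is such a subgroup of `H`.
[cite: MochizukiAbsTopI2012, Def 1.1 (iii) p.10] -/
theorem IsAlmostProOmissive.of_continuousMulEquiv (e : A ≃ₜ* B) (h : IsAlmostProOmissive A) :
    IsAlmostProOmissive B := by
  obtain ⟨p, U, hp, hUo, hU⟩ := h.exists_open_proOmissive
  refine ⟨⟨p, U.map e.toMulEquiv.toMonoidHom, hp, ?_, ?_⟩⟩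
  · rw [coe_map_continuousMulEquiv_eq_image]
    exact e.toHomeomorph.isOpenMap _ hUo
  · obtain ⟨eU⟩ := nonempty_continuousMulEquiv_map_subgroup e U
    exact hU.of_surjective (eU : U →ₜ* (U.map e.toMulEquiv.toMonoidHom : Subgroup B)) eU.surjective

omit [IsTopologicalGroup A] [IsTopologicalGroup B] in
/-- Almost pro-omissivity of a subgroup passes to its image along `e`.
[cite: MochizukiAbsTopI2012, Def 1.1 (iii) p.10] -/
theorem isAlmostProOmissive_map_continuousMulEquiv (e : A ≃ₜ* B) {N : Subgroup A}
    (hN : IsAlmostProOmissive N) :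
    IsAlmostProOmissive (N.map e.toMulEquiv.toMonoidHom : Subgroup B) := by
  obtain ⟨eN⟩ := nonempty_continuousMulEquiv_map_subgroup e N
  exact hN.of_continuousMulEquiv eN

/-- The four properties "normal, closed, topologically finitely generated, almost pro-omissive" of a
subgroup pass to its image along `e`. [cite: MochizukiAbsTopI2012, Thm 2.6 (v) p.22] -/
theorem apoNormal_map_continuousMulEquiv (e : A ≃ₜ* B) {N : Subgroup A}
    (h : N.Normal ∧ IsClosed (N : Set A) ∧ IsTopologicallyFinitelyGenerated N ∧ IsAlmostProOmissive N) :
    (N.map e.toMulEquiv.toMonoidHom).Normal ∧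
      IsClosed ((N.map e.toMulEquiv.toMonoidHom : Subgroup B) : Set B) ∧
      IsTopologicallyFinitelyGenerated (N.map e.toMulEquiv.toMonoidHom : Subgroup B) ∧
      IsAlmostProOmissive (N.map e.toMulEquiv.toMonoidHom : Subgroup B) := by
  obtain ⟨hn, hc, ht, ha⟩ := h
  refine ⟨hn.map e.toMulEquiv.toMonoidHom e.surjective, ?_,
    isTopologicallyFinitelyGenerated_map_continuousMulEquiv e ht,
    isAlmostProOmissive_map_continuousMulEquiv e ha⟩
  rw [coe_map_continuousMulEquiv_eq_image]
  exact e.toHomeomorph.isClosedMap _ hc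

/-- **"Maximal almost pro-omissive tfg closed normal subgroup" transports along `e`**: if `N ⊆ A` is
one, so is `e(N) ⊆ B` (a competitor `N' ⊇ e(N)` pulls back to a competitor `e⁻¹(N') ⊇ N`).
[cite: MochizukiAbsTopI2012, Thm 2.6 (v) p.22] -/
theorem isMaximalAPONormal_map_continuousMulEquiv (e : A ≃ₜ* B) {N : Subgroup A}
    (h : IsMaximalAPONormal A N) : IsMaximalAPONormal B (N.map e.toMulEquiv.toMonoidHom) := by
  refine ⟨apoNormal_map_continuousMulEquiv e h.1, ?_⟩
  intro N' hn' hc' ht' ha' hle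
  -- pull the competitor back along `e`
  have h' : (N'.map e.symm.toMulEquiv.toMonoidHom).Normal ∧
      IsClosed ((N'.map e.symm.toMulEquiv.toMonoidHom : Subgroup A) : Set A) ∧
      IsTopologicallyFinitelyGenerated (N'.map e.symm.toMulEquiv.toMonoidHom : Subgroup A) ∧
      IsAlmostProOmissive (N'.map e.symm.toMulEquiv.toMonoidHom : Subgroup A) :=
    apoNormal_map_continuousMulEquiv e.symm ⟨hn', hc', ht', ha'⟩
  have hle' : N ≤ N'.map e.symm.toMulEquiv.toMonoidHom := by
    intro x hx
    rw [mem_map_continuousMulEquiv_iff_symm_mem, e.symm_symm]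
    exact hle ⟨x, hx, rfl⟩
  have heq : N'.map e.symm.toMulEquiv.toMonoidHom = N := h.2 _ h'.1 h'.2.1 h'.2.2.1 h'.2.2.2 hle'
  -- push forward again
  have := congrArg (fun K : Subgroup A => K.map e.toMulEquiv.toMonoidHom) heq
  rw [← this]
  have hback : (N'.map e.symm.toMulEquiv.toMonoidHom).map e.toMulEquiv.toMonoidHom = N' := by
    have h2 := map_map_symm_continuousMulEquiv e.symm N'
    rw [e.symm_symm] at h2
    exact h2
  exact hback.symm

/-- The transport is an equivalence: `N ↦ e(N)` identifies the maximal almost pro-omissive tfg closed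
normal subgroups of `A` and of `B`. [cite: MochizukiAbsTopI2012, Thm 2.6 (v) p.22] -/
theorem isMaximalAPONormal_map_continuousMulEquiv_iff (e : A ≃ₜ* B) (N : Subgroup A) :
    IsMaximalAPONormal B (N.map e.toMulEquiv.toMonoidHom) ↔ IsMaximalAPONormal A N := by
  refine ⟨fun h => ?_, isMaximalAPONormal_map_continuousMulEquiv e⟩
  have h' := isMaximalAPONormal_map_continuousMulEquiv e.symm h
  rwa [map_map_symm_continuousMulEquiv] at h'

/-- Unique existence of the maximal subgroup is an invariant of the topological group.
[cite: MochizukiAbsTopI2012, Thm 2.6 (v) p.22] -/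
theorem existsUnique_isMaximalAPONormal_iff (e : A ≃ₜ* B) :
    (∃! N : Subgroup A, IsMaximalAPONormal A N) ↔ ∃! N : Subgroup B, IsMaximalAPONormal B N := by
  constructor
  · rintro ⟨N, hN, huniq⟩
    refine ⟨N.map e.toMulEquiv.toMonoidHom, isMaximalAPONormal_map_continuousMulEquiv e hN, ?_⟩
    intro N' hN'
    have h1 : IsMaximalAPONormal A (N'.map e.symm.toMulEquiv.toMonoidHom) :=
      isMaximalAPONormal_map_continuousMulEquiv e.symm hN'
    have h2 := huniq _ h1
    have h3 := congrArg (fun K : Subgroup A => K.map e.toMulEquiv.toMonoidHom) h2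
    have h4 := map_map_symm_continuousMulEquiv e.symm N'
    rw [e.symm_symm] at h4
    rw [h4] at h3
    exact h3
  · rintro ⟨N, hN, huniq⟩
    refine ⟨N.map e.symm.toMulEquiv.toMonoidHom, isMaximalAPONormal_map_continuousMulEquiv e.symm hN, ?_⟩
    intro N' hN'
    have h1 : IsMaximalAPONormal B (N'.map e.toMulEquiv.toMonoidHom) :=
      isMaximalAPONormal_map_continuousMulEquiv e hN'
    have h2 := huniq _ h1
    have h3 := congrArg (fun K : Subgroup B => K.map e.symm.toMulEquiv.toMonoidHom) h2
    rw [map_map_symm_continuousMulEquiv e N'] at h3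
    exact h3

/-! ### `Θ` and `ζ̃` are "group-theoretic" -/

/-- **`e(Θ_A) = Θ_B`**: the subgroup `Θ` of [AbsTopI] Thm 2.6 (v) is transported by every isomorphism of
topological groups (`θ²` is invariant, `thetaSet_eq_of_continuousMulEquiv`; the maximal almost
pro-omissive tfg closed normal subgroup, when unique, corresponds under `e`; `{1} ↦ {1}`).
[cite: MochizukiAbsTopI2012, Thm 2.6 (v) p.22] -/
theorem thetaSubgroup_map_continuousMulEquiv (e : A ≃ₜ* B) :
    (thetaSubgroup A).map e.toMulEquiv.toMonoidHom = thetaSubgroup B := by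
  classical
  have hθ : thetaSet A 2 = thetaSet B 2 := thetaSet_eq_of_continuousMulEquiv e 2
  by_cases hA : thetaSet A 2 ≠ {l | l.Prime} ∧ ∃! N : Subgroup A, IsMaximalAPONormal A N
  · have hB : thetaSet B 2 ≠ {l | l.Prime} ∧ ∃! N : Subgroup B, IsMaximalAPONormal B N :=
      ⟨hθ ▸ hA.1, (existsUnique_isMaximalAPONormal_iff e).mp hA.2⟩
    have hA' : thetaSubgroup A = Classical.choose hA.2 := by
      unfold thetaSubgroup; rw [dif_pos hA]
    have hB' : thetaSubgroup B = Classical.choose hB.2 := by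
      unfold thetaSubgroup; rw [dif_pos hB]
    rw [hA', hB']
    -- both are THE maximal subgroup; `e` carries the one of `A` to a maximal subgroup of `B`
    have h1 : IsMaximalAPONormal B ((Classical.choose hA.2).map e.toMulEquiv.toMonoidHom) :=
      isMaximalAPONormal_map_continuousMulEquiv e (Classical.choose_spec hA.2).1
    exact hB.2.unique h1 (Classical.choose_spec hB.2).1
  · have hB : ¬ (thetaSet B 2 ≠ {l | l.Prime} ∧ ∃! N : Subgroup B, IsMaximalAPONormal B N) := by
      intro hB
      exact hA ⟨hθ.symm ▸ hB.1, (existsUnique_isMaximalAPONormal_iff e).mpr hB.2⟩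
    have hA' : thetaSubgroup A = ⊥ := by
      unfold thetaSubgroup; rw [dif_neg hA]
    have hB' : thetaSubgroup B = ⊥ := by
      unfold thetaSubgroup; rw [dif_neg hB]
    rw [hA', hB', Subgroup.map_bot]

/-- `A/Θ_A ⥲ B/Θ_B` bicontinuously (existence form), along `e`. [cite: MochizukiAbsTopI2012, Thm 2.6 (v) p.22] -/
theorem nonempty_continuousMulEquiv_quotient_thetaSubgroup (e : A ≃ₜ* B) :
    Nonempty (A ⧸ (thetaSubgroup A).normalCore ≃ₜ* B ⧸ (thetaSubgroup B).normalCore) := by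
  have hmap : ((thetaSubgroup A).normalCore).map e.toMulEquiv.toMonoidHom =
      (thetaSubgroup B).normalCore := by
    rw [normalCore_thetaSubgroup, normalCore_thetaSubgroup]
    exact thetaSubgroup_map_continuousMulEquiv e
  let q : A ⧸ (thetaSubgroup A).normalCore ≃* B ⧸ (thetaSubgroup B).normalCore :=
    QuotientGroup.congr (thetaSubgroup A).normalCore (thetaSubgroup B).normalCore e.toMulEquiv hmap
  have hq : Continuous q := by
    rw [← QuotientGroup.isOpenQuotientMap_mk.continuous_comp_iff]
    have : (q : A ⧸ (thetaSubgroup A).normalCore → B ⧸ (thetaSubgroup B).normalCore) ∘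
        QuotientGroup.mk = QuotientGroup.mk ∘ e := funext fun _ => rfl
    rw [this]
    exact continuous_quotient_mk'.comp e.continuous
  have hq' : Continuous q.symm := by
    rw [← QuotientGroup.isOpenQuotientMap_mk.continuous_comp_iff]
    have : (q.symm : B ⧸ (thetaSubgroup B).normalCore → A ⧸ (thetaSubgroup A).normalCore) ∘
        QuotientGroup.mk = QuotientGroup.mk ∘ e.symm := by
      funext y
      apply q.injective
      change q (q.symm (QuotientGroup.mk y)) = q (QuotientGroup.mk (e.symm y))
      rw [q.apply_symm_apply]
      change (QuotientGroup.mk y : B ⧸ (thetaSubgroup B).normalCore) = QuotientGroup.mk (e (e.symm y))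
      rw [e.apply_symm_apply]
    rw [this]
    exact continuous_quotient_mk'.comp e.symm.continuous
  exact ⟨{ q with continuous_toFun := hq, continuous_invFun := hq' }⟩

/-- **`ζ̃(A) = ζ̃(B)`**: the invariant `ζ̃(Π) := ζ(Π/Θ)` of [AbsTopI] Thm 2.6 (v) is "group-theoretic".
[cite: MochizukiAbsTopI2012, Thm 2.6 (v) p.22] -/
theorem zetaTildeInv_eq_of_continuousMulEquiv (e : A ≃ₜ* B) : zetaTildeInv A = zetaTildeInv B := by
  obtain ⟨q⟩ := nonempty_continuousMulEquiv_quotient_thetaSubgroup e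
  exact zetaInv_eq_of_continuousMulEquiv q

omit [IsTopologicalGroup A] [IsTopologicalGroup B] in
/-- The index of the preimage of a subgroup along `e` equals the index. [folklore] -/
private theorem index_comap_continuousMulEquiv_eq (e : A ≃ₜ* B) (H : Subgroup B) :
    (H.comap e.toMulEquiv.toMonoidHom).index = H.index :=
  Subgroup.index_comap_of_surjective H e.surjective

end Transport

/-! ### `Δ ⊆ Π` is characteristic under the general-`Θ` characterization -/

namespace FundamentalExtension

variable {E F : FundamentalExtension.{u}}

/-- **Transport of the Thm 2.6 (v) `ζ̃`-characterization**: if in BOTH extensions `Δ` is "the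
intersection of the open subgroups `H ⊆ Π` such that `ζ̃(H)/ζ̃(Π) = [Π : H]`" (second conjunct of
`Thm26vFull`), then every isomorphism of topological groups `φ : Π_E ⥲ Π_F` carries `Δ_E` onto `Δ_F`:
`φ` induces a bijection of open subgroups preserving `[Π : H]` and `ζ̃`.
[cite: MochizukiAbsTopI2012, Thm 2.6 (v) p.22] -/
theorem geom_map_eq_of_zetaTilde_characterization
    (hE : E.geom = ⨅ (H : Subgroup E.arith) (_ : IsOpen (H : Set E.arith))
      (_ : zetaTildeInv H = (H.index : ℕ∞) * zetaTildeInv E.arith), H)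
    (hF : F.geom = ⨅ (H : Subgroup F.arith) (_ : IsOpen (H : Set F.arith))
      (_ : zetaTildeInv H = (H.index : ℕ∞) * zetaTildeInv F.arith), H)
    (φ : E.arith ≃ₜ* F.arith) : E.geom.map φ.toMulEquiv.toMonoidHom = F.geom := by
  -- one inclusion for an arbitrary isomorphism, then symmetry
  have key : ∀ {E F : FundamentalExtension.{u}},
      (E.geom = ⨅ (H : Subgroup E.arith) (_ : IsOpen (H : Set E.arith))
        (_ : zetaTildeInv H = (H.index : ℕ∞) * zetaTildeInv E.arith), H) →
      (F.geom = ⨅ (H : Subgroup F.arith) (_ : IsOpen (H : Set F.arith))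
        (_ : zetaTildeInv H = (H.index : ℕ∞) * zetaTildeInv F.arith), H) →
      ∀ (φ : E.arith ≃ₜ* F.arith) (x : E.arith), x ∈ E.geom → φ x ∈ F.geom := by
    intro E F hE hF φ x hx
    rw [hF]
    simp only [Subgroup.mem_iInf]
    intro H hHopen hHζ
    -- pull `H` back to `Π_E`
    set H' : Subgroup E.arith := H.comap φ.toMulEquiv.toMonoidHom with hH'
    have hH'open : IsOpen (H' : Set E.arith) := hHopen.preimage φ.continuous
    obtain ⟨e⟩ := nonempty_continuousMulEquiv_comap_subgroup φ H
    have hH'ζ : zetaTildeInv H' = (H'.index : ℕ∞) * zetaTildeInv E.arith := by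
      rw [hH', index_comap_continuousMulEquiv_eq φ H, zetaTildeInv_eq_of_continuousMulEquiv e,
        zetaTildeInv_eq_of_continuousMulEquiv φ]
      exact hHζ
    have hxH' : x ∈ H' := by
      rw [hE] at hx
      simp only [Subgroup.mem_iInf] at hx
      exact hx H' hH'open hH'ζ
    exact hxH'
  refine le_antisymm ?_ ?_
  · rintro y ⟨x, hx, rfl⟩
    exact key hE hF φ x hx
  · intro y hy
    refine ⟨φ.symm y, key hF hE φ.symm y hy, φ.apply_symm_apply y⟩

/-- **[AbsTopI] Thm 2.6 (v), general form ⇒ `Δ ⊆ Π` is "group-theoretic"**: for two extensions with MLF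
base data satisfying the typed Thm 2.6 (v) in its general-`Θ` form (`Thm26vFull`), every isomorphism of
topological groups `Π_E ⥲ Π_F` carries `Δ_E` onto `Δ_F` — the [AbsAnab] Lemma 1.3.8 shape `PreservesGeom`
(the form cited by [IUTchI] p. 73 / [IUTchII] pp. 35, 71, 120). [cite: MochizukiAbsTopI2012, Thm 2.6 (v) p.22] -/
theorem preservesGeom_of_thm26vFull {BE : E.MLFBase} {BF : F.MLFBase} (hE : E.Thm26vFull BE)
    (hF : F.Thm26vFull BF) (α : E.arith ≃ₜ* F.arith) : PreservesGeom α :=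
  geom_map_eq_of_zetaTilde_characterization hE.2 hF.2 α

/-- Self-form: under `Thm26vFull`, `Δ_E` is carried onto itself by EVERY automorphism of the topological
group `Π_E` (the hypothesis shape `∀ φ, PreservesGeom φ` of the tempered/curve-level (H1) reductions).
[cite: MochizukiAbsTopI2012, Thm 2.6 (v) p.22] -/
theorem geom_map_eq_self_of_thm26vFull {B : E.MLFBase} (h : E.Thm26vFull B)
    (φ : E.arith ≃ₜ* E.arith) : E.geom.map φ.toMulEquiv.toMonoidHom = E.geom :=
  preservesGeom_of_thm26vFull h h φ

/-- The first conjunct of `Thm26vFull` is "group-theoretic" too: `ζ̃(Π_E) = ζ̃(Π_F)` along any isomorphism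
of topological groups `Π_E ⥲ Π_F`. [cite: MochizukiAbsTopI2012, Thm 2.6 (v) p.22] -/
theorem zetaTildeInv_arith_eq_of_continuousMulEquiv (e : E.arith ≃ₜ* F.arith) :
    zetaTildeInv E.arith = zetaTildeInv F.arith :=
  zetaTildeInv_eq_of_continuousMulEquiv e

end FundamentalExtension

end Literature.AnabelianGeometry.AbsoluteAnabelian

end
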